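import Literature.AlgebraicGeometry.Resolution.HasseSchmidtFrobeniusCongruence
import Literature.AlgebraicGeometry.Resolution.HasseSchmidtLocalCriterion
import Literature.AlgebraicGeometry.Resolution.HasseSchmidtEtaleLift
import HarnessLib

/-!
# Purity of the initial form in characteristic `p`, read off the Hasse–Schmidt coefficients of degree `q = p^e`

Topic: `Literature/AlgebraicGeometry/Resolution`. Setting of `HasseSchmidtLocalCriterion.lean` /
`HasseSchmidtFrobeniusCongruence.lean`: a commutative ring `O` of exponential characteristic `p`, a ring homomorphism
`T : O → O⟦t_σ⟧` (`σ` finite) with `constantCoeff ∘ T = id` — a Hasse–Schmidt homomorphism with components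
`D^{[β]} = hsComponent T β` — and, for the local statements, `O` LOCAL with generators `u_i` of `𝔪` adapted to `T` to
first order (`D^{[e_j]} u_i ≡ δ_ij mod 𝔪`). Call a multi-index `β` of degree `q = p^e` PURE if `β = q·e_m` for some
`m`, NON-PURE otherwise. PROVED:

* `exists_not_dvd_of_ne_smul_single` — a non-pure `β` of degree `q` has a coordinate not divisible by `q`;
* `hsComponent_mem_of_sub_pow_mem` — **necessity, any ideal `I`, no locality**: if `h ≡ y^q (mod I^{q+1})` then
  `D^{[β]} h ∈ I` for every NON-PURE `β` of degree `q` (`D^{[β]}(y^q) = 0` off the lattice `qℕ^σ`,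
  `hsComponent_pow_expChar_pow_eq_zero_of_not_dvd`, and `D^{[β]}(I^{q+1}) ⊆ I`);
* `residue_hsComponent_single_sum_mul` — for adapted generators, `D^{[e_m]}(Σ_l a_l u_l) ≡ a_m (mod 𝔪)`;
* `exists_sub_pow_mem_of_hsComponent_mem` — **sufficiency, local, residue field with `q`-th roots** (e.g. perfect):
  if `h ∈ 𝔪^q` and `D^{[β]} h ∈ 𝔪` for every non-pure `β` of degree `q`, then `h ≡ y^q (mod 𝔪^{q+1})` for some
  `y ∈ 𝔪` — namely `y = Σ_m a_m u_m` with `ā_m^q = (D^{[q e_m]} h)‾`; checked through the order criterion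
  `mem_maximalIdeal_pow_succ_of_hsComponent_mem` and the Frobenius rule `D^{[q e_m]}(y^q) = (D^{[e_m]} y)^q`;
* `sub_pow_mem_iff_hsComponent_mem` — the equivalence, for `h ∈ 𝔪^q`.

In words: at a point with adapted Hasse–Schmidt data the initial form of `h` (degree `q = p^e`) is the `q`-th power of
a linear form iff the NON-PURE Hasse–Schmidt coefficients of degree `q` vanish at the point. Combined with ONE global
Hasse–Schmidt homomorphism of an étale chart (`HasseSchmidtChartOrder.lean`), the locus of closed points where this
happens is cut out by global sections.

Bearing (nothing of it asserted): step (ii) «purity correction» of the discharge route for GAP-LEDGER row R20 (Th. 6.14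
(1) of H. Hironaka's 2017 manuscript) in the campaign `res-hironaka`: «a form of degree `q_i` is a `q_i`-th power of a
linear form iff its coefficients on the non-pure monomials vanish iff `(D^{(β)}·)(η) = 0` for all `|β| = q_i`,
`β ∉ q_i·{e_m}`» (lead README §2 (ii), `κ_η` perfect).

Sources: [Matsumura1987] §27 (higher derivations `E_t` are ring homomorphisms, so `E_t(a^p) = E_t(a)^p`), §30 (proof of
Thm. 30.9: coefficients of `p`-th powers); [EGAIV4] Thm. 16.11.2; [Abad2019pBases] Lemma 6.2 (Hasse–Schmidt derivatives
on `p^e`-th powers); [VillamayorU2008ReesDiff] §4.1, Remark 4.3 (order and initial forms via differential operators).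
-/

noncomputable section

namespace Literature.AlgebraicGeometry.Resolution

open Finsupp IsLocalRing MvPowerSeries

universe v

/-! ## Pure and non-pure multi-indices of degree `q` -/

section Indices

variable {σ : Type*}

/-- Two multi-indices with `β ≤ γ` and `|γ| ≤ |β|` are equal. [folklore] -/
private theorem eq_of_le_of_degree_le' {β γ : σ →₀ ℕ} (hle : β ≤ γ) (hdeg : degree γ ≤ degree β) : β = γ := by
  obtain ⟨c, rfl⟩ := exists_add_of_le hle
  have hc : degree c = 0 := by
    rw [map_add] at hdeg
    omega
  rw [degree_eq_zero_iff] at hc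
  rw [hc, add_zero]

/-- **A non-pure multi-index of degree `q > 0` has a coordinate not divisible by `q`**: if `|β| = q` and `β ≠ q·e_m`
for every `m`, then `q ∤ β_s` for some `s` (were all coordinates multiples of `q`, a non-zero one would equal `q` and
carry the whole degree). [cite: Matsumura1987, §30 (proof of Thm. 30.9: exponents of the monomials of a `p`-th power are
multiples of `p`)] -/
theorem exists_not_dvd_of_ne_smul_single {q : ℕ} (hq : 0 < q) {β : σ →₀ ℕ} (hβ : degree β = q)
    (hne : ∀ m, β ≠ q • Finsupp.single m 1) : ∃ s, ¬ q ∣ β s := by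
  by_contra hall
  push Not at hall
  have hβ0 : β ≠ 0 := by
    intro h0
    rw [h0, map_zero] at hβ
    omega
  obtain ⟨s, hs⟩ := Finsupp.support_nonempty_iff.mpr hβ0
  have hs' : β s ≠ 0 := Finsupp.mem_support_iff.mp hs
  obtain ⟨k, hk⟩ := hall s
  have hle : β s ≤ q := hβ ▸ Finsupp.le_degree s β
  have hk1 : k = 1 := by
    have hk0 : k ≠ 0 := fun h0 => hs' (by rw [hk, h0, mul_zero])
    have : q * k ≤ q * 1 := by rw [mul_one, ← hk]; exact hle
    have := Nat.le_of_mul_le_mul_left this hq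
    omega
  rw [hk1, mul_one] at hk
  -- `β = single s q = q • single s 1`
  have hsingle : Finsupp.single s q ≤ β := Finsupp.single_le_iff.mpr hk.ge
  have heq : Finsupp.single s q = β :=
    eq_of_le_of_degree_le' hsingle (by rw [degree_single, hβ])
  exact hne s (by rw [Finsupp.smul_single_one, heq])

end Indices

/-! ## Necessity: off the lattice `qℕ^σ` the components kill `q`-th powers -/

section Necessity

variable {O : Type v} [CommRing O] {σ : Type*} (T : O →+* MvPowerSeries σ O) (p : ℕ) [ExpChar O p]

omit [ExpChar O p] in
/-- Components are compatible with subtraction. [folklore] -/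
private theorem hsComponent_sub' (β : σ →₀ ℕ) (a b : O) :
    hsComponent T β (a - b) = hsComponent T β a - hsComponent T β b := by
  simp [hsComponent]

/-- **Necessity of the purity conditions** (any ideal, no locality): if `h − y^{p^e} ∈ I^{p^e + 1}` then
`D^{[β]} h ∈ I` for every NON-PURE `β` of degree `p^e` — since `D^{[β]}(y^{p^e}) = 0` (some coordinate of `β` is not a
multiple of `p^e`) and `D^{[β]}(I^{p^e+1}) ⊆ I^{p^e + 1 − |β|} = I`. [cite: Matsumura1987, §27 and §30 (proof of
Thm. 30.9)] [cite: Abad2019pBases, Lemma 6.2] -/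
theorem hsComponent_mem_of_sub_pow_mem (hT0 : ∀ b, constantCoeff (T b) = b) (I : Ideal O) {e : ℕ} {h y : O}
    (hy : h - y ^ p ^ e ∈ I ^ (p ^ e + 1)) {β : σ →₀ ℕ} (hβ : degree β = p ^ e)
    (hne : ∀ m, β ≠ p ^ e • Finsupp.single m 1) : hsComponent T β h ∈ I := by
  obtain ⟨s, hs⟩ := exists_not_dvd_of_ne_smul_single (expChar_pow_pos O p e) hβ hne
  have h1 : hsComponent T β (y ^ p ^ e) = 0 := hsComponent_pow_expChar_pow_eq_zero_of_not_dvd T p ⟨s, hs⟩ y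
  have h2 : hsComponent T β (h - y ^ p ^ e) ∈ I ^ (p ^ e + 1 - degree β) := hsComponent_mem_pow T hT0 I _ β hy
  rw [hβ, show p ^ e + 1 - p ^ e = 1 by omega, pow_one, hsComponent_sub', h1, sub_zero] at h2
  exact h2

end Necessity

/-! ## Sufficiency in a local ring with adapted generators and `q`-th roots in the residue field -/

section Sufficiency

variable {O : Type v} [CommRing O] [IsLocalRing O] {σ : Type*} [Fintype σ] [DecidableEq σ]
  (T : O →+* MvPowerSeries σ O) (p : ℕ) [ExpChar O p]

omit [Fintype σ] [ExpChar O p] in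
/-- First-order adaptation in the residue field: `(D^{[e_j]} u_i)‾ = δ_ij`. [folklore] -/
private theorem residue_hsComponent_single_adapted {u : σ → O}
    (hlin : ∀ i j, hsComponent T (single j 1) (u i) - (if i = j then 1 else 0) ∈ maximalIdeal O) (i j : σ) :
    residue O (hsComponent T (single j 1) (u i)) = if i = j then 1 else 0 := by
  have := hlin i j
  rw [← residue_eq_zero_iff, map_sub, sub_eq_zero] at this
  rw [this]
  split_ifs <;> simp

omit [ExpChar O p] in
/-- **`D^{[e_m]}(Σ_l a_l u_l) ≡ a_m (mod 𝔪)`** for generators `u_i ∈ 𝔪` adapted to `T` to first order (the degree-one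
components are derivations: `D^{[e_m]}(a u) = D^{[e_m]}(a)·u + a·D^{[e_m]}(u)`). [cite: Matsumura1987, §27 (higher
derivations: the first component is a derivation)] -/
theorem residue_hsComponent_single_sum_mul (hT0 : ∀ b, constantCoeff (T b) = b) {u : σ → O}
    (hu : Ideal.span (Set.range u) = maximalIdeal O)
    (hlin : ∀ i j, hsComponent T (single j 1) (u i) - (if i = j then 1 else 0) ∈ maximalIdeal O)
    (a : σ → O) (m : σ) :
    residue O (hsComponent T (single m 1) (∑ l, a l * u l)) = residue O (a m) := by
  have hu𝔪 : ∀ i, u i ∈ maximalIdeal O := fun i => hu ▸ Ideal.subset_span ⟨i, rfl⟩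
  have hsum : hsComponent T (single m 1) (∑ l, a l * u l) = ∑ l, hsComponent T (single m 1) (a l * u l) := by
    simp only [hsComponent, map_sum]
  rw [hsum, map_sum]
  have hterm : ∀ l ∈ (Finset.univ : Finset σ),
      residue O (hsComponent T (single m 1) (a l * u l)) = if l = m then residue O (a m) else 0 := by
    intro l _
    rw [hsComponent_single_mul T hT0, map_add, map_mul, map_mul, (residue_eq_zero_iff _).mpr (hu𝔪 l), mul_zero,
      zero_add, residue_hsComponent_single_adapted T hlin]
    split_ifs with hlm
    · rw [hlm, mul_one]
    · rw [mul_zero]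
  rw [Finset.sum_congr rfl hterm, Finset.sum_ite_eq' Finset.univ m, if_pos (Finset.mem_univ m)]

/-- **Sufficiency of the purity conditions.** `O` local of exponential characteristic `p`, `T` a Hasse–Schmidt
homomorphism with adapted generators `u_i` of `𝔪`, and every element of the residue field a `p^e`-th power (e.g. `κ`
perfect). If `h ∈ 𝔪^{p^e}` and `D^{[β]} h ∈ 𝔪` for every NON-PURE `β` of degree `p^e`, then `h − y^{p^e} ∈ 𝔪^{p^e + 1}`
for some `y ∈ 𝔪`: take `y = Σ_m a_m u_m` with `ā_m^{p^e} = (D^{[p^e e_m]} h)‾`; every component of degree `≤ p^e` of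
`h − y^{p^e}` lies in `𝔪` (non-pure ones: hypothesis and `D^{[β]}(y^{p^e}) = 0`; pure ones: the Frobenius rule
`D^{[p^e e_m]}(y^{p^e}) = (D^{[e_m]} y)^{p^e} ≡ a_m^{p^e}`; lower ones: `h − y^{p^e} ∈ 𝔪^{p^e}`), so the order criterion
applies. [cite: Matsumura1987, §27 and §30 (proof of Thm. 30.9)] [cite: VillamayorU2008ReesDiff, §4.1 and Remark 4.3]
[cite: Abad2019pBases, Lemma 6.2] -/
theorem exists_sub_pow_mem_of_hsComponent_mem (hT0 : ∀ b, constantCoeff (T b) = b) {u : σ → O}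
    (hu : Ideal.span (Set.range u) = maximalIdeal O)
    (hlin : ∀ i j, hsComponent T (single j 1) (u i) - (if i = j then 1 else 0) ∈ maximalIdeal O)
    {e : ℕ} (hroot : ∀ x : ResidueField O, ∃ y : ResidueField O, y ^ p ^ e = x) {h : O}
    (hh : h ∈ maximalIdeal O ^ p ^ e)
    (hD : ∀ β : σ →₀ ℕ, degree β = p ^ e → (∀ m, β ≠ p ^ e • Finsupp.single m 1) →
      hsComponent T β h ∈ maximalIdeal O) :
    ∃ y ∈ maximalIdeal O, h - y ^ p ^ e ∈ maximalIdeal O ^ (p ^ e + 1) := by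
  classical
  have hqpos : 0 < p ^ e := expChar_pow_pos O p e
  -- `p^e`-th roots of the pure coefficients, lifted to `O`
  have hlift : ∀ m : σ, ∃ a : O,
      residue O a ^ p ^ e = residue O (hsComponent T (p ^ e • single m 1) h) := by
    intro m
    obtain ⟨ybar, hybar⟩ := hroot (residue O (hsComponent T (p ^ e • single m 1) h))
    obtain ⟨a, ha⟩ := residue_surjective ybar
    exact ⟨a, by rw [ha, hybar]⟩
  choose a ha using hlift
  have hu𝔪 : ∀ i, u i ∈ maximalIdeal O := fun i => hu ▸ Ideal.subset_span ⟨i, rfl⟩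
  set y : O := ∑ m, a m * u m with hy
  have hy𝔪 : y ∈ maximalIdeal O := Ideal.sum_mem _ fun m _ => Ideal.mul_mem_left _ _ (hu𝔪 m)
  refine ⟨y, hy𝔪, ?_⟩
  have hr : h - y ^ p ^ e ∈ maximalIdeal O ^ p ^ e := sub_mem hh (Ideal.pow_mem_pow hy𝔪 _)
  refine mem_maximalIdeal_pow_succ_of_hsComponent_mem T hT0 hu hlin (p ^ e) (h - y ^ p ^ e) fun γ hγ => ?_
  rcases hγ.lt_or_eq with hlt | heq
  · -- components of degree `< p^e` of an element of `𝔪^{p^e}`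
    exact Ideal.pow_le_self (by omega) (hsComponent_mem_pow T hT0 (maximalIdeal O) (p ^ e) γ hr)
  · rw [hsComponent_sub']
    by_cases hpure : ∃ m, γ = p ^ e • single m 1
    · -- pure index: Frobenius rule and the choice of `a_m`
      obtain ⟨m, rfl⟩ := hpure
      rw [hsComponent_smul_pow_expChar_pow T p e (single m 1) y, ← residue_eq_zero_iff, map_sub, map_pow,
        residue_hsComponent_single_sum_mul T hT0 hu hlin a m, ha m, sub_self]
    · -- non-pure index: hypothesis, and `D^{[γ]}(y^{p^e}) = 0`
      push Not at hpure
      rw [hsComponent_pow_expChar_pow_eq_zero_of_not_dvd T p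
        (exists_not_dvd_of_ne_smul_single hqpos heq hpure) y, sub_zero]
      exact hD γ heq hpure

/-- **Purity criterion** (the equivalence). In the setting of `exists_sub_pow_mem_of_hsComponent_mem`, for `h ∈ 𝔪^{p^e}`:
`(∃ y, h − y^{p^e} ∈ 𝔪^{p^e+1}) ⟺ D^{[β]} h ∈ 𝔪` for every non-pure `β` of degree `p^e`; and the witness `y` may be
taken in `𝔪`. The initial form of `h` in degree `p^e` is a `p^e`-th power of a linear form iff its NON-PURE
Hasse–Schmidt coefficients vanish at the point. [cite: Matsumura1987, §27 and §30 (proof of Thm. 30.9)]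
[cite: VillamayorU2008ReesDiff, §4.1 and Remark 4.3] [cite: Abad2019pBases, Lemma 6.2] -/
theorem sub_pow_mem_iff_hsComponent_mem (hT0 : ∀ b, constantCoeff (T b) = b) {u : σ → O}
    (hu : Ideal.span (Set.range u) = maximalIdeal O)
    (hlin : ∀ i j, hsComponent T (single j 1) (u i) - (if i = j then 1 else 0) ∈ maximalIdeal O)
    {e : ℕ} (hroot : ∀ x : ResidueField O, ∃ y : ResidueField O, y ^ p ^ e = x) {h : O}
    (hh : h ∈ maximalIdeal O ^ p ^ e) :
    (∃ y, h - y ^ p ^ e ∈ maximalIdeal O ^ (p ^ e + 1)) ↔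
      ∀ β : σ →₀ ℕ, degree β = p ^ e → (∀ m, β ≠ p ^ e • Finsupp.single m 1) →
        hsComponent T β h ∈ maximalIdeal O := by
  constructor
  · rintro ⟨y, hy⟩ β hβ hne
    exact hsComponent_mem_of_sub_pow_mem T p hT0 (maximalIdeal O) hy hβ hne
  · intro hD
    obtain ⟨y, -, hy⟩ := exists_sub_pow_mem_of_hsComponent_mem T p hT0 hu hlin hroot hh hD
    exact ⟨y, hy⟩

end Sufficiency

end Literature.AlgebraicGeometry.Resolution

end
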